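import Summits.KontsevichZagierPeriods.Zeta5Search.WedgeDictionaryRankThreeProof
import HarnessLib

/-!
# The dual-side determinant identities: `2×2` minors of `(U, W, V)` along slot 7 and the rank-three Casoratian

HONEST FRAMING: systematic search; no irrationality claim unless certified.

OUR work (Summit side; cell `pub-zeta5`, P1 seat generation 4; planner gen-1 g5's memo `D2-FEASIBILITY-g5.md` §3,
"Apéry-type determinant identities").  For three consecutive slot-7 points `b, b′ = b+e₇, b″ = b+2e₇` the three `2×2`
minors of the matrix `[(U,W,V)(b); (U,W,V)(b′); (U,W,V)(b″)]` —
`M₃ = U∧W` (`quadM3`, the `Q`-part of the dictionary up to `ρ`), `U∧V` (`casUV`, conjecturally `P̂/ρ`) and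
`V∧W` (`casVW`, conjecturally `P/ρ`) — satisfy the Plücker-type identities (THEOREMS, unconditional, identities of
rational numbers):
* `M₃(b)·(U∧V)(b′) − (U∧V)(b)·M₃(b′) =  U(b′)·C₃(b)`   (`quadM3_casUV_step`),
* `M₃(b)·(V∧W)(b′) − (V∧W)(b)·M₃(b′) = −W(b′)·C₃(b)`   (`quadM3_casVW_step`),
* `(U∧V)(b)·(V∧W)(b′) − (V∧W)(b)·(U∧V)(b′) = −V(b′)·C₃(b)` (`casUV_casVW_step`),
with `C₃ = cas3` given in CLOSED FORM by CF-W3 (`rankThreeClosedForm_holds`) and `M₃` by CF-M3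
(`OmegaRec.casoratianClosedForm_holds`).  So the discrete "Wronskian" of the ratio `(U∧V)/M₃` (the dual-side shadow of
`P̂/Q → ` a `ζ(3)`-type limit) is `U(b′)·C₃(b)/(M₃(b)M₃(b′))` with everything but `U(b′)` in closed form — Apéry's
phenomenon along a slot.  Under the (conjectural, exactly verified) `P̂`- and `P`-parts of `wedgeDictionary` these become
gen-1 g5's cellular-side identities `Q(a)P̂(a′) − P̂(a)Q(a′) = ρ(a)ρ(a′)·C₃(b)·U(b′)` (checked 11/11; conditional on D2 —
NOT claimed here).  What this is NOT: a statement about irrationality.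
-/

open Finset

namespace Summit.KontsevichZagierPeriods.Zeta5Search.WedgeDictionary

open Summit.KontsevichZagierPeriods.Zeta5Search.DualSeries

namespace CFW3

/-- The slot-7 minor `U(b)W(b+e₇) − U(b+e₇)W(b)` is `M₃(b)` (`wedgeQ_eq_quadM3` in slot 7). -/
theorem quadM3_eq_slot7 (b : ℕ → ℤ) (hb : InBox b) (hd : 0 ≤ dOf b) (h7 : b 7 ≤ b 0) :
    quadM3 b = coeffU b * coeffW (bump b 6) - coeffU (bump b 6) * coeffW b :=
  (wedgeQ_eq_quadM3 b hb hd (i := 6) (mem_range.2 (by norm_num)) h7).symm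

/-- Both slot-7 minors `M₃(b)`, `M₃(b+e₇)` in coordinates (`d(b) ≥ 1`, `b₇ + 1 ≤ N`). -/
theorem quadM3_pair_slot7 (b : ℕ → ℤ) (hb : InBox b) (hd : 1 ≤ dOf b) (h7 : b 7 + 1 ≤ b 0) :
    quadM3 b = coeffU b * coeffW (bump b 6) - coeffU (bump b 6) * coeffW b ∧
      quadM3 (bump b 6) = coeffU (bump b 6) * coeffW (bump (bump b 6) 6) -
        coeffU (bump (bump b 6) 6) * coeffW (bump b 6) := by
  have h67 : (6 : ℕ) ∈ range 7 := mem_range.2 (by norm_num)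
  refine ⟨quadM3_eq_slot7 b hb (by omega) (by omega), quadM3_eq_slot7 (bump b 6) (inBox_bump6 b hb (by omega)) ?_ ?_⟩
  · rw [dOf_bump b h67]; omega
  · rw [bump6_seven, bump_zero]; exact h7

end CFW3

/-- **`M₃(b)·(U∧V)(b+e₇) − (U∧V)(b)·M₃(b+e₇) = U(b+e₇)·C₃(b)`** (for `b` in the box, `d(b) ≥ 1`, `b₇ + 1 ≤ N`). -/
theorem quadM3_casUV_step (b : ℕ → ℤ) (hb : InBox b) (hd : 1 ≤ dOf b) (h7 : b 7 + 1 ≤ b 0) :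
    quadM3 b * casUV (bump b 6) - casUV b * quadM3 (bump b 6) = coeffU (bump b 6) * cas3 b := by
  obtain ⟨h0, h1⟩ := CFW3.quadM3_pair_slot7 b hb hd h7
  rw [h0, h1]
  unfold casUV cas3
  ring

/-- **`M₃(b)·(V∧W)(b+e₇) − (V∧W)(b)·M₃(b+e₇) = −W(b+e₇)·C₃(b)`**. -/
theorem quadM3_casVW_step (b : ℕ → ℤ) (hb : InBox b) (hd : 1 ≤ dOf b) (h7 : b 7 + 1 ≤ b 0) :
    quadM3 b * casVW (bump b 6) - casVW b * quadM3 (bump b 6) = -(coeffW (bump b 6) * cas3 b) := by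
  obtain ⟨h0, h1⟩ := CFW3.quadM3_pair_slot7 b hb hd h7
  rw [h0, h1]
  unfold casVW cas3
  ring

/-- **`(U∧V)(b)·(V∧W)(b+e₇) − (V∧W)(b)·(U∧V)(b+e₇) = −V(b+e₇)·C₃(b)`** (no hypotheses: an identity of minors). -/
theorem casUV_casVW_step (b : ℕ → ℤ) :
    casUV b * casVW (bump b 6) - casVW b * casUV (bump b 6) = -(coeffV (bump b 6) * cas3 b) := by
  unfold casUV casVW cas3
  ring

/-- **The Apéry-type increment, closed part.** On the CF-W3 region (`b₇ + 2 ≤ N`, `d(b) ≥ 1`, pair sums `≤ N`):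
`[M₃(b)·(U∧V)(b+e₇) − (U∧V)(b)·M₃(b+e₇)] · ∏_{j<k}(N−b_j−b_k)! = U(b+e₇) · (−1)^{N+1} · 4 · (d−1)! · ∏_j b_j!`. -/
theorem quadM3_casUV_step_closed (b : ℕ → ℤ) (hb : InBox b) (h72 : b 7 + 2 ≤ b 0) (hd : 1 ≤ dOf b)
    (hpairs : ∀ jk ∈ allPairs, b jk.1 + b jk.2 ≤ b 0) :
    (quadM3 b * casUV (bump b 6) - casUV b * quadM3 (bump b 6)) *
        (allPairs.map fun jk => ((b 0 - b jk.1 - b jk.2).toNat.factorial : ℚ)).prod =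
      coeffU (bump b 6) * ((-1 : ℚ) ^ ((b 0).toNat + 1) * 4 * ((dOf b - 1).toNat.factorial : ℚ) *
        ∏ j ∈ range 7, ((b (j + 1)).toNat.factorial : ℚ)) := by
  rw [quadM3_casUV_step b hb hd (by omega), mul_assoc, rankThreeClosedForm_holds b hb h72 hd hpairs]

end Summit.KontsevichZagierPeriods.Zeta5Search.WedgeDictionary
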